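import Summits.Ventures.Crystal3D.Theorems.StickyWulffConstantPolycrystalWulffBoundRungTwinFreeTwoClassesOverlap

/-!
# `PolycrystalWulffBound`, line `PolyDensity`: the computational hypotheses of lane P, BY NAME

Route `StickyWulffConstant` of the venture `Summits/Ventures/Crystal3D`, crux `PolycrystalWulffBound`
(item `stmt-Ventures-19482`), second prover lane (poly-p2, gen 4), as asked by the route planner
(cf-p1 g24, ROUTE §82 «CH-P1 / CH-P2»): the overlap constants of the fcc Wulff body
`W(A) = {y | ∀ ν, ⟪y, ν⟫ ≤ Φ(A⁻¹ν)}` (`|W| = 32`, `W(A) = A '' W(1)`) that the middle-band rungs of line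
`PolyDensity` take as hypotheses, stated once as named `Prop`s so that every rung cites them by name.

* `WulffPairOverlap κ` : `∀ R, κ ≤ |W(1) ∩ W(R)|` — **CH-P1** is `WulffOverlap27_5 := WulffPairOverlap 27.5`.
  CERTIFICATE (computational grade, evidence #13 on the crux item, HOME/poly-p2/CERT-wulffOverlap-27.5.md):
  kit job j292055 — Lipschitz–Steiner branch and bound over the cubic disorientation fundamental zone,
  14 743 416 exact polytope volumes, minimal certified leaf lower bound `27.5000011`; the sampled minimum
  is `27.9013` at the 90° rotation about `⟨110⟩` (kit j291496, 206/206 Nelder–Mead starts agree), so the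
  true constant is `27.90 ± 1e-3`.
* `WulffTripleOverlap κ` : `∀ R₁ R₂, κ ≤ |W(1) ∩ W(R₁) ∩ W(R₂)|` — **CH-P2** is
  `WulffTripleOverlap25_5 := WulffTripleOverlap 25.5`.  NO certificate: numerically the minimum is
  `25.813` (kit j291769); a certified enclosure is a 6-dimensional branch and bound which the
  Lipschitz–Steiner method of j292055 does not reach (poly-p2 g4, HOME/poly-p2/MIDDLE-BAND-g4.md).
  The same memo records that CH-P2 is AVOIDABLE: by inclusion–exclusion inside `W(1)`,
  `WulffPairOverlap κ → WulffTripleOverlap (2κ − 32)` (`wulffTripleOverlap_of_pair` below), and the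
  3-class LP closes with the pair constant alone once `κ ≈ 27.8`.
* `rung_twinFree_twoClasses_of_WulffOverlap27_5` : the landed two-class rung
  (`rung_twinFree_twoClasses_of_overlap`, p578755) restated with the hypothesis BY NAME.

WHAT THIS IS NOT: a proof of either constant (they are hypotheses here); F-C1 not moved.
-/

noncomputable section

open scoped BigOperators InnerProductSpace ENNReal
open MeasureTheory

namespace Summit.Ventures.Crystal3D.Cruxes.PolycrystalWulffBound.PolyDensity

open Summit.Ventures.Crystal3D.Theorems

/-- **Pairwise Wulff-body overlap constant** `κ`: every rotated (or reflected) copy `W(R)` of the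
crux's fcc Wulff body meets `W(1)` in volume at least `κ` (the crux's `let`-vocabulary for `Λ`, `Φ`,
`W`, with `W(1) = W (LinearIsometryEquiv.refl)`). -/
def WulffPairOverlap (κ : ℝ) : Prop :=
    let Λ : Set (EuclideanSpace ℝ (Fin 3)) := Literature.MathematicalPhysics.StatisticalMechanics.fccStacking 1 (Real.sqrt (2 / 3));
    let Φ : EuclideanSpace ℝ (Fin 3) → ℝ := fun ν => Real.sqrt 2 / 4 * ∑ᶠ w ∈ {w ∈ Λ | ‖w‖ = 1}, |⟪w, ν⟫_ℝ|;
    let W : (EuclideanSpace ℝ (Fin 3) ≃ₗᵢ[ℝ] EuclideanSpace ℝ (Fin 3)) → Set (EuclideanSpace ℝ (Fin 3)) := fun A => {y | ∀ ν : EuclideanSpace ℝ (Fin 3), ⟪y, ν⟫_ℝ ≤ Φ (A.symm ν)};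
    ∀ R : EuclideanSpace ℝ (Fin 3) ≃ₗᵢ[ℝ] EuclideanSpace ℝ (Fin 3),
      κ ≤ (volume (W (LinearIsometryEquiv.refl ℝ (EuclideanSpace ℝ (Fin 3))) ∩ W R)).toReal

/-- **CH-P1** (cf-p1 ROUTE §82): the pairwise overlap constant `27.5` — certified by kit job j292055
(branch and bound, evidence #13 on `stmt-Ventures-19482`); the true minimum is `27.9013` (90° about `⟨110⟩`). -/
def WulffOverlap27_5 : Prop := WulffPairOverlap 27.5

/-- **Triple Wulff-body overlap constant** `κ`: any two rotated copies meet `W(1)` jointly in volume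
at least `κ`. -/
def WulffTripleOverlap (κ : ℝ) : Prop :=
    let Λ : Set (EuclideanSpace ℝ (Fin 3)) := Literature.MathematicalPhysics.StatisticalMechanics.fccStacking 1 (Real.sqrt (2 / 3));
    let Φ : EuclideanSpace ℝ (Fin 3) → ℝ := fun ν => Real.sqrt 2 / 4 * ∑ᶠ w ∈ {w ∈ Λ | ‖w‖ = 1}, |⟪w, ν⟫_ℝ|;
    let W : (EuclideanSpace ℝ (Fin 3) ≃ₗᵢ[ℝ] EuclideanSpace ℝ (Fin 3)) → Set (EuclideanSpace ℝ (Fin 3)) := fun A => {y | ∀ ν : EuclideanSpace ℝ (Fin 3), ⟪y, ν⟫_ℝ ≤ Φ (A.symm ν)};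
    ∀ R₁ R₂ : EuclideanSpace ℝ (Fin 3) ≃ₗᵢ[ℝ] EuclideanSpace ℝ (Fin 3),
      κ ≤ (volume (W (LinearIsometryEquiv.refl ℝ (EuclideanSpace ℝ (Fin 3))) ∩ W R₁ ∩ W R₂)).toReal

/-- **CH-P2** (cf-p1 ROUTE §82): the triple overlap constant `25.5` — NOT certified (numerical minimum
`25.813`, kit j291769; a certificate would be a 6-dimensional branch and bound).  See
`wulffTripleOverlap_of_pair` for the certified substitute `2·27.5 − 32 = 23`. -/
def WulffTripleOverlap25_5 : Prop := WulffTripleOverlap 25.5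

/-- The overlap constants are monotone in the constant. -/
theorem WulffPairOverlap.mono {κ κ' : ℝ} (h : WulffPairOverlap κ) (hle : κ' ≤ κ) :
    WulffPairOverlap κ' := fun R => hle.trans (h R)

/-- The triple overlap constants are monotone in the constant. -/
theorem WulffTripleOverlap.mono {κ κ' : ℝ} (h : WulffTripleOverlap κ) (hle : κ' ≤ κ) :
    WulffTripleOverlap κ' := fun R₁ R₂ => hle.trans (h R₁ R₂)

/-- Inclusion–exclusion in `toReal` form: for measurable `S`, `U`, a set `S` of volume `32` meeting each of
`T`, `U` in volume `≥ κ` meets both in volume `≥ 2κ − 32`. -/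
theorem toReal_volume_inter_inter_ge {S T U : Set (EuclideanSpace ℝ (Fin 3))}
    (hSm : MeasurableSet S) (hU : MeasurableSet U) (hS : volume S = ENNReal.ofReal 32) {κ : ℝ}
    (h1 : κ ≤ (volume (S ∩ T)).toReal) (h2 : κ ≤ (volume (S ∩ U)).toReal) :
    2 * κ - 32 ≤ (volume (S ∩ T ∩ U)).toReal := by
  have hfin : ∀ X, X ⊆ S → volume X ≠ ⊤ := fun X hX =>
    (lt_of_le_of_lt (measure_mono hX) (by rw [hS]; exact ENNReal.ofReal_lt_top)).ne
  -- `|A ∪ B| + |A ∩ B| = |A| + |B|` for `A = S ∩ T`, `B = S ∩ U`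
  have hAB : volume ((S ∩ T) ∪ (S ∩ U)) + volume ((S ∩ T) ∩ (S ∩ U)) =
      volume (S ∩ T) + volume (S ∩ U) :=
    measure_union_add_inter _ (hSm.inter hU)
  have hset : (S ∩ T) ∩ (S ∩ U) = S ∩ T ∩ U := by
    ext y; simp only [Set.mem_inter_iff]; tauto
  have hUle : volume ((S ∩ T) ∪ (S ∩ U)) ≤ ENNReal.ofReal 32 := by
    rw [← hS]; exact measure_mono (Set.union_subset Set.inter_subset_left Set.inter_subset_left)
  rw [hset] at hAB
  have e1 : volume (S ∩ T) ≠ ⊤ := hfin _ Set.inter_subset_left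
  have e2 : volume (S ∩ U) ≠ ⊤ := hfin _ Set.inter_subset_left
  have e3 : volume (S ∩ T ∩ U) ≠ ⊤ := hfin _ (Set.inter_subset_left.trans Set.inter_subset_left)
  have e4 : volume ((S ∩ T) ∪ (S ∩ U)) ≠ ⊤ :=
    hfin _ (Set.union_subset Set.inter_subset_left Set.inter_subset_left)
  have hreal := congrArg ENNReal.toReal hAB
  rw [ENNReal.toReal_add e4 e3, ENNReal.toReal_add e1 e2] at hreal
  have hU' : (volume ((S ∩ T) ∪ (S ∩ U))).toReal ≤ 32 := by
    have := ENNReal.toReal_mono ENNReal.ofReal_ne_top hUle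
    rwa [ENNReal.toReal_ofReal (by norm_num)] at this
  linarith

/-- **Inclusion–exclusion inside `W(1)`**: a pair constant `κ` gives the triple constant `2κ − 32`
(`|A ∩ B| ≥ |A| + |B| − |W(1)|` for `A = W(1) ∩ W(R₁)`, `B = W(1) ∩ W(R₂)`, both inside `W(1)`,
`|W(1)| = 32`).  With CH-P1 this is the CERTIFIED triple constant `23`. -/
theorem wulffTripleOverlap_of_pair {κ : ℝ} (h : WulffPairOverlap κ) :
    WulffTripleOverlap (2 * κ - 32) := by
  intro R₁ R₂
  exact toReal_volume_inter_inter_ge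
    (isCompact_cruxWulffBody (LinearIsometryEquiv.refl ℝ (EuclideanSpace ℝ (Fin 3)))).measurableSet
    (isCompact_cruxWulffBody R₂).measurableSet
    (volume_cruxWulffBody (LinearIsometryEquiv.refl ℝ (EuclideanSpace ℝ (Fin 3)))) (h R₁) (h R₂)

/-- The landed two-class rung `rung_twinFree_twoClasses_of_overlap` (p578755) with its computational
hypothesis cited BY NAME: **CH-P1 ⟹ twin-free polyhedral textures with at most two lattice classes
satisfy the polycrystal Wulff bound.** -/
theorem rung_twinFree_twoClasses_of_WulffOverlap27_5 (hCH : WulffOverlap27_5) :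
    let Λ : Set (EuclideanSpace ℝ (Fin 3)) := Literature.MathematicalPhysics.StatisticalMechanics.fccStacking 1 (Real.sqrt (2 / 3));
    let Brl : (ℤ → ℤ) → Set (EuclideanSpace ℝ (Fin 3)) := Literature.MathematicalPhysics.StatisticalMechanics.barlowStacking 1 (Real.sqrt (2 / 3));
    let Ax : EuclideanSpace ℝ (Fin 3) → (EuclideanSpace ℝ (Fin 3) ≃ₗᵢ[ℝ] EuclideanSpace ℝ (Fin 3)) → (EuclideanSpace ℝ (Fin 3) ≃ₗᵢ[ℝ] EuclideanSpace ℝ (Fin 3)) → Prop := fun m A B => ∃ (L : EuclideanSpace ℝ (Fin 3) ≃ₗᵢ[ℝ] EuclideanSpace ℝ (Fin 3)) (s₁ s₂ : EuclideanSpace ℝ (Fin 3)) (σ σ' : ℤ → ℤ), Literature.MathematicalPhysics.StatisticalMechanics.IsHaggSeq σ ∧ Literature.MathematicalPhysics.StatisticalMechanics.IsHaggSeq σ' ∧ L (EuclideanSpace.single (2 : Fin 3) (1 : ℝ)) = m ∧ A '' Λ ⊆ (fun q => L q + s₁) '' Brl σ ∧ B '' Λ ⊆ (fun q => L q + s₂)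 '' Brl σ';
    let CoAx : (EuclideanSpace ℝ (Fin 3) ≃ₗᵢ[ℝ] EuclideanSpace ℝ (Fin 3)) → (EuclideanSpace ℝ (Fin 3) ≃ₗᵢ[ℝ] EuclideanSpace ℝ (Fin 3)) → Prop := fun A B => ∃ m, Ax m A B;
    let Φ : EuclideanSpace ℝ (Fin 3) → ℝ := fun ν => Real.sqrt 2 / 4 * ∑ᶠ w ∈ {w ∈ Λ | ‖w‖ = 1}, |⟪w, ν⟫_ℝ|;
    let Per : Set (EuclideanSpace ℝ (Fin 3)) → Set (EuclideanSpace ℝ (Fin 3)) → ℝ := fun K S => (⨆ (ξ : EuclideanSpace ℝ (Fin 3) → EuclideanSpace ℝ (Fin 3)) (_ : ContDiff ℝ 1 ξ ∧ HasCompactSupport ξ ∧ ∀ z, ξ z ∈ K), ENNReal.ofReal (∫ z in S, Literature.MathematicalPhysics.StatisticalMechanics.fieldDivergence ξ z)).toReal;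
    let ι : Set (EuclideanSpace ℝ (Fin 3)) → Set (EuclideanSpace ℝ (Fin 3)) → Set (EuclideanSpace ℝ (Fin 3)) → ℝ := fun K S₁ S₂ => (Per K S₁ + Per K S₂ - Per K (S₁ ∪ S₂)) / 2;
    let W : (EuclideanSpace ℝ (Fin 3) ≃ₗᵢ[ℝ] EuclideanSpace ℝ (Fin 3)) → Set (EuclideanSpace ℝ (Fin 3)) := fun A => {y | ∀ ν : EuclideanSpace ℝ (Fin 3), ⟪y, ν⟫_ℝ ≤ Φ (A.symm ν)};
    let Dsc : EuclideanSpace ℝ (Fin 3) → Set (EuclideanSpace ℝ (Fin 3)) := fun m => {y | ‖y‖ ≤ 1 ∧ ⟪y, m⟫_ℝ = 0};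
    let Tex : (n : ℕ) → (Fin n → Set (EuclideanSpace ℝ (Fin 3))) → (Fin n → (EuclideanSpace ℝ (Fin 3) ≃ₗᵢ[ℝ] EuclideanSpace ℝ (Fin 3))) → (Fin n → Fin n → ℝ) → (Fin n → Fin n → EuclideanSpace ℝ (Fin 3)) → Prop := fun n G A c m => (∀ f : Fin n, Literature.MathematicalPhysics.StatisticalMechanics.HasFinitePerimeter (G f) ∧ volume (G f) < ⊤) ∧ (∀ f g, f ≠ g → Disjoint (G f) (G g)) ∧ (∀ f g, f ≠ g → 0 ≤ c f g) ∧ (∀ f g, f ≠ g → ¬ CoAx (A f) (A g) → m f g = 0 ∧ 1 ≤ c f g) ∧ (∀ f g, f ≠ g → CoAx (A f) (A g) → A f '' Λ ≠ A g '' Λ → Ax (m f g) (A f) (A g) ∧ 1 / 2 ≤ c f g);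
    let En : (n : ℕ) → (Fin n → Set (EuclideanSpace ℝ (Fin 3))) → (Fin n → (EuclideanSpace ℝ (Fin 3) ≃ₗᵢ[ℝ] EuclideanSpace ℝ (Fin 3))) → (Fin n → Fin n → ℝ) → (Fin n → Fin n → EuclideanSpace ℝ (Fin 3)) → ℝ := fun n G A c m => ∑ f : Fin n, Per (W (A f)) (G f) - ∑ f, ∑ g, (if f = g then 0 else ι (W (A f)) (G f) (G g)) + ∑ f, ∑ g, (if f = g then 0 else c f g / 2 * ι (Dsc (m f g)) (G f) (G g));
    let Vol : (n : ℕ) → (Fin n → Set (EuclideanSpace ℝ (Fin 3))) → ℝ := fun n G => (volume (⋃ f : Fin n, G f)).toReal;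
    let Poly : Set (EuclideanSpace ℝ (Fin 3)) → Prop := fun S => ∃ (k : ℕ) (H : Fin k → Finset ((EuclideanSpace ℝ (Fin 3)) × ℝ)), S = ⋃ i, ⋂ p ∈ H i, {x | ⟪p.1, x⟫_ℝ < p.2};
    let TF : (n : ℕ) → (Fin n → (EuclideanSpace ℝ (Fin 3) ≃ₗᵢ[ℝ] EuclideanSpace ℝ (Fin 3))) → Prop := fun n A => ∀ f g : Fin n, f ≠ g → CoAx (A f) (A g) → A f '' Λ = A g '' Λ;
    ∀ (n : ℕ) (G : Fin n → Set (EuclideanSpace ℝ (Fin 3))) (A : Fin n → (EuclideanSpace ℝ (Fin 3) ≃ₗᵢ[ℝ] EuclideanSpace ℝ (Fin 3))) (c : Fin n → Fin n → ℝ) (m : Fin n → Fin n → EuclideanSpace ℝ (Fin 3)), Tex n G A c m → (∀ f, Poly (G f)) → TF n A → (∀ f g h : Fin n, A f '' Λ = A g '' Λ ∨ A g '' Λ = A h '' Λ ∨ A f '' Λ = A h '' Λ) → 6 * (2 : ℝ) ^ ((1 : ℝ) / 3) * (Real.sqrt 2 * Vol n G) ^ ((2 : ℝ) / 3) ≤ En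 n G A c m := by
  intro Λ Brl Ax CoAx Φ Per ι W Dsc Tex En Vol Poly TF n G A c m hTex hPoly hTF hTwo
  exact rung_twinFree_twoClasses_of_overlap n G A c m hTex hPoly hTF hTwo hCH

/-- **CH-P1′** (poly-p2 gen 4, `MIDDLE-BAND-g4.md`): the pairwise overlap constant `27.8` — the
computational hypothesis of the three-class middle-band rung `rung_twinFree_threeClasses_of_overlap`
(`…RungTwinFreeThreeClasses`, via the typed certificate `cert3_k278`).  Certificate: Lipschitz–Steiner
branch and bound over the cubic fundamental zone (kit jobs `j293556…j293563`, six parts, and the finer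
twelve-part run `j295443…`; ledger `poly-p2/CERT-wulffOverlap-27.8.md`); the true minimum is `27.9013`.
It implies CH-P1 (`WulffPairOverlap.mono`) and, by `wulffTripleOverlap_of_pair`, the triple constant `23.6`. -/
def WulffOverlap27_8 : Prop := WulffPairOverlap 27.8

/-- CH-P1′ implies CH-P1. -/
theorem WulffOverlap27_8.to27_5 (h : WulffOverlap27_8) : WulffOverlap27_5 :=
  WulffPairOverlap.mono h (by norm_num)

end Summit.Ventures.Crystal3D.Cruxes.PolycrystalWulffBound.PolyDensity

end
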